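import Mathlib.MeasureTheory.Integral.Prod
import Mathlib.MeasureTheory.Function.LocallyIntegrable
import Literature.Barriers.AtomisticToContinuum.EnergyAsymptoticsWithoutCondensationPoisson

/-!
# Comparison principle and sandwich bounds for the Love / Lieb–Liniger equation

Second of the sibling files proving the named fact
`Literature.Barriers.AtomisticToContinuum.EnergyAsymptoticsWithoutCondensation`
(= `BoseGas.LiebLiniger.LiebLiniger_bogoliubovTwoOrders`, LSSY (B.19) to two orders).  Everything
here is about an arbitrary continuous solution `g` on `[-1, 1]` of the Love form of (B.14),
`g(k) = 1/(2π) + (1/π)∫_{-1}^{1} g(p) P_κ(k, p) dp`, `P_κ(k,p) = κ/(κ² + (p-k)²)`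
(`poissonKernel`), stated with explicit hypotheses `hg`, `hgeq` (no new definitions):

* `IsGroundStateDensity.rescale_eq` & co.: a solution `f` of (B.14)–(B.15) on `[-K, K]` with
  coupling `c` gives such a `g(q) = f(Kq)` with `κ = c/K`, `∫g = ρ/K`, `∫g q² = K⁻³∫f k²`.
* `le_of_subsolution`, `le_of_supersolution`: the **comparison principle** (maximum of `u - g` on
  `[-1,1]` against `K_κ 1 ≤ (2/π) arctan(2/κ) < 1`, `integral_poissonKernel_le`).
* `sqrt_div_le_solution`: the semicircle `√(1-k²)/(2πκ)` is a subsolution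
  (`K_κ[√(1-·²)] = B - κ`, file 1), hence `g ≥ √(1-k²)/(2πκ) ≥ 0` and `∫g ≥ 1/(4κ)` — the one-sided,
  all-`γ` form of LSSY's `f ≈ (2πργ)⁻¹(4ρ²γ - k²)^{1/2}` in (B.19).
* `solution_le_sqrt_div`: for `a > 1`, `θ = κa²/(2(a²-1)^{3/2}) < 1`, the stretched semicircle
  `√(a²-k²)/(2πκ(1-θ))` is a supersolution, hence an upper bound.
* `solution_le_const`, `integral_solution_le`: `g ≤ 1/(4 arctan(κ/2))`, so small `γ = κ/∫g`
  forces small `κ`.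
* `duality`: `∫ v g - (1/π)∫ (K_κ v) g = (1/2π)∫ v` for continuous `v` (Fubini, symmetric kernel) —
  the identity through which the closed forms of file 1 enter the moments of `g`.

## References

* [LSSY2005] E. H. Lieb, R. Seiringer, J. P. Solovej, J. Yngvason, *The Mathematics of the Bose
  Gas and its Condensation*, Birkhäuser 2005, App. B (B.14)–(B.19).
* [TracyWidom2016] C. A. Tracy, H. Widom, J. Phys. A 49 (2016) 294001, §1.1 (Love form,
  `‖K‖ = (2/π) arctan(1/κ)`).
-/

noncomputable section

open MeasureTheory Set Filter Real intervalIntegral Metric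
open scoped Topology

namespace Literature.Barriers.AtomisticToContinuum.BoseGas.LiebLiniger

/-! ### Rescaling `[-K, K] → [-1, 1]` -/

section Rescale

variable {c ρ K : ℝ} {f : ℝ → ℝ}

/-- The rescaled density `q ↦ f(Kq)` is continuous on `[-1, 1]`. [folklore] -/
theorem IsGroundStateDensity.continuousOn_rescale (hf : IsGroundStateDensity c ρ K f) :
    ContinuousOn (fun q => f (K * q)) (Icc (-1) 1) := by
  refine hf.continuousOn.comp (by fun_prop) ?_
  intro q hq
  have hK := hf.K_pos
  constructor <;> nlinarith [hq.1, hq.2]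

/-- The Lieb–Liniger equation (B.14) in Love form for the rescaled density:
`g(k) = 1/(2π) + (1/π)∫_{-1}^{1} g(p) P_κ(k,p) dp` with `κ = c/K`, `g(q) = f(Kq)`.
[cite: LSSY2005, App. B (B.14)] -/
theorem IsGroundStateDensity.rescale_eq (hf : IsGroundStateDensity c ρ K f) (hc : 0 < c) :
    ∀ k ∈ Icc (-1 : ℝ) 1, f (K * k)
      = 1 / (2 * π) + π⁻¹ * ∫ p in (-1 : ℝ)..1, f (K * p) * poissonKernel (c / K) k p := by
  intro k hk
  have hK := hf.K_pos
  have hmem : K * k ∈ Icc (-K) K := by constructor <;> nlinarith [hk.1, hk.2]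
  have heq := hf.eq (K * k) hmem
  have hsub := intervalIntegral.smul_integral_comp_mul_left
    (fun p => f p / (c ^ 2 + (p - K * k) ^ 2)) K (a := -1) (b := 1)
  simp only [mul_neg, mul_one, smul_eq_mul] at hsub
  rw [← hsub] at heq
  have hpt : ∀ p : ℝ, f (K * p) / (c ^ 2 + (K * p - K * k) ^ 2)
      = (K * c)⁻¹ * (f (K * p) * poissonKernel (c / K) k p) := by
    intro p
    simp only [poissonKernel]
    have h2 : (c / K) ^ 2 + (p - k) ^ 2 ≠ 0 := by positivity
    have h3 : c ^ 2 + (K * p - K * k) ^ 2 ≠ 0 := by positivity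
    field_simp
  simp_rw [hpt] at heq
  rw [intervalIntegral.integral_const_mul] at heq
  set I := ∫ p in (-1 : ℝ)..1, f (K * p) * poissonKernel (c / K) k p
  have hI : 2 * c * (K * ((K * c)⁻¹ * I)) = 2 * I := by field_simp
  rw [hI] at heq
  have hπ := Real.pi_pos
  field_simp
  linarith

/-- `∫_{-1}^{1} f(Kq) dq = (1/K)∫_{-K}^{K} f`. [folklore] -/
theorem IsGroundStateDensity.integral_rescale (hf : IsGroundStateDensity c ρ K f) :
    ∫ q in (-1 : ℝ)..1, f (K * q) = ρ / K := by
  have hK := hf.K_pos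
  have hsub := intervalIntegral.smul_integral_comp_mul_left f K (a := -1) (b := 1)
  simp only [mul_neg, mul_one, smul_eq_mul, hf.norm] at hsub
  field_simp
  linarith

/-- `∫_{-1}^{1} f(Kq) q² dq = (1/K³)∫_{-K}^{K} f(k) k² dk`. [folklore] -/
theorem IsGroundStateDensity.integral_rescale_sq (hf : IsGroundStateDensity c ρ K f) :
    ∫ q in (-1 : ℝ)..1, f (K * q) * q ^ 2 = (∫ k in (-K)..K, f k * k ^ 2) / K ^ 3 := by
  have hK := hf.K_pos
  have hsub := intervalIntegral.smul_integral_comp_mul_left (fun p => f p * p ^ 2) K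
    (a := -1) (b := 1)
  simp only [mul_neg, mul_one, smul_eq_mul] at hsub
  rw [← hsub]
  have : ∀ q : ℝ, f (K * q) * (K * q) ^ 2 = K ^ 2 * (f (K * q) * q ^ 2) := by intro q; ring
  simp_rw [this, intervalIntegral.integral_const_mul]
  field_simp

end Rescale

/-! ### The kernel has mass `< π` on `[-1, 1]` -/

/-- `∫_{k-2}^{k+2} P_κ(k, p) dp = 2 arctan(2/κ)`. [folklore] -/
lemma integral_poissonKernel_symm {κ : ℝ} (hκ : 0 < κ) (k : ℝ) :
    ∫ p in (k - 2)..(k + 2), poissonKernel κ k p = 2 * arctan (2 / κ) := by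
  have h := intervalIntegral.integral_comp_mul_add (fun p => poissonKernel κ k p) hκ.ne' k
    (a := -(2 / κ)) (b := 2 / κ)
  have h1 : κ * -(2 / κ) + k = k - 2 := by field_simp; ring
  have h2 : κ * (2 / κ) + k = k + 2 := by field_simp; ring
  rw [h1, h2, smul_eq_mul] at h
  have hpt : ∀ x : ℝ, poissonKernel κ k (κ * x + k) = κ⁻¹ * (1 + x ^ 2)⁻¹ := by
    intro x
    simp only [poissonKernel]
    have : (1 : ℝ) + x ^ 2 ≠ 0 := by positivity
    field_simp
    ring
  simp_rw [hpt, intervalIntegral.integral_const_mul] at h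
  have h3 : ∫ x in -(2 / κ)..2 / κ, (1 + x ^ 2)⁻¹ = 2 * arctan (2 / κ) := by
    have := integral_inv_one_add_sq (a := -(2 / κ)) (b := 2 / κ)
    rw [this, Real.arctan_neg]
    ring
  rw [h3] at h
  field_simp at h
  linarith

/-- `∫_{-1}^{1} P_κ(k, p) dp ≤ 2 arctan(2/κ) < π` for `k ∈ [-1, 1]`. [folklore] -/
lemma integral_poissonKernel_le {κ : ℝ} (hκ : 0 < κ) {k : ℝ} (hk : k ∈ Icc (-1 : ℝ) 1) :
    ∫ p in (-1 : ℝ)..1, poissonKernel κ k p ≤ 2 * arctan (2 / κ) := by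
  rw [← integral_poissonKernel_symm hκ k]
  apply intervalIntegral.integral_mono_interval (by linarith [hk.2]) (by norm_num)
    (by linarith [hk.1])
  · exact Filter.Eventually.of_forall fun p => (poissonKernel_pos hκ k p).le
  · exact (continuous_poissonKernel hκ k).intervalIntegrable _ _

/-- `2 arctan(2/κ) = π - 2 arctan(κ/2) < π`. [folklore] -/
lemma two_arctan_two_div {κ : ℝ} (hκ : 0 < κ) :
    2 * arctan (2 / κ) = π - 2 * arctan (κ / 2) := by
  have : 2 / κ = (κ / 2)⁻¹ := by field_simp
  rw [this, Real.arctan_inv_of_pos (by positivity)]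
  ring

/-! ### Comparison principle for the Love equation -/

section Comparison

variable {κ : ℝ} {g u : ℝ → ℝ}

/-- Integrability of `u · P_κ(k, ·)` on `[-1, 1]` for `u` continuous there. [folklore] -/
lemma intervalIntegrable_mul_poissonKernel (hκ : 0 < κ) (hu : ContinuousOn u (Icc (-1) 1))
    (k : ℝ) : IntervalIntegrable (fun p => u p * poissonKernel κ k p) volume (-1) 1 := by
  apply ContinuousOn.intervalIntegrable
  rw [uIcc_of_le (by norm_num)]
  exact hu.mul (continuous_poissonKernel hκ k).continuousOn

/-- **Comparison principle (subsolutions).** If `g` solves the Love equation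
`g = 1/(2π) + K_κ g` on `[-1,1]` and `u ≤ 1/(2π) + K_κ u` there (both continuous), then `u ≤ g`.
Proof: at a maximum point of `u - g` the inequality `u - g ≤ K_κ(u - g)` contradicts
`K_κ 1 < 1`. [folklore] -/
theorem le_of_subsolution (hκ : 0 < κ) (hg : ContinuousOn g (Icc (-1) 1))
    (hgeq : ∀ k ∈ Icc (-1 : ℝ) 1,
      g k = 1 / (2 * π) + π⁻¹ * ∫ p in (-1 : ℝ)..1, g p * poissonKernel κ k p)
    (hu : ContinuousOn u (Icc (-1) 1))
    (husub : ∀ k ∈ Icc (-1 : ℝ) 1,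
      u k ≤ 1 / (2 * π) + π⁻¹ * ∫ p in (-1 : ℝ)..1, u p * poissonKernel κ k p) :
    ∀ k ∈ Icc (-1 : ℝ) 1, u k ≤ g k := by
  have hw : ContinuousOn (fun k => u k - g k) (Icc (-1) 1) := hu.sub hg
  obtain ⟨k₀, hk₀, hmax⟩ :=
    isCompact_Icc.exists_isMaxOn (nonempty_Icc.2 (by norm_num)) hw
  by_contra H
  push Not at H
  obtain ⟨k₁, hk₁, hlt⟩ := H
  set m := u k₀ - g k₀ with hm
  have hm_pos : 0 < m := lt_of_lt_of_le (by linarith) (hmax hk₁)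
  have hle : ∀ p ∈ Icc (-1 : ℝ) 1, u p - g p ≤ m := fun p hp => hmax hp
  -- `m ≤ (1/π) ∫ (u - g) P ≤ (m/π) ∫ P ≤ (m/π)·2 arctan(2/κ) < m`
  have h1 : m ≤ π⁻¹ * ∫ p in (-1 : ℝ)..1, (u p - g p) * poissonKernel κ k₀ p := by
    have := husub k₀ hk₀
    rw [hgeq k₀ hk₀] at hm
    have hsplit : ∫ p in (-1 : ℝ)..1, (u p - g p) * poissonKernel κ k₀ p
        = (∫ p in (-1 : ℝ)..1, u p * poissonKernel κ k₀ p)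
          - ∫ p in (-1 : ℝ)..1, g p * poissonKernel κ k₀ p := by
      rw [← intervalIntegral.integral_sub (intervalIntegrable_mul_poissonKernel hκ hu k₀)
        (intervalIntegrable_mul_poissonKernel hκ hg k₀)]
      congr 1; ext p; ring
    rw [hsplit, mul_sub]
    linarith
  have h2 : ∫ p in (-1 : ℝ)..1, (u p - g p) * poissonKernel κ k₀ p
      ≤ ∫ p in (-1 : ℝ)..1, m * poissonKernel κ k₀ p := by
    apply intervalIntegral.integral_mono_on (by norm_num)
      (intervalIntegrable_mul_poissonKernel hκ hw k₀)
      ((continuous_poissonKernel hκ k₀).intervalIntegrable _ _ |>.const_mul m)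
    intro p hp
    exact mul_le_mul_of_nonneg_right (hle p hp) (poissonKernel_pos hκ k₀ p).le
  rw [intervalIntegral.integral_const_mul] at h2
  have h3 := integral_poissonKernel_le hκ hk₀
  have h4 := two_arctan_two_div hκ
  have h5 : 0 < arctan (κ / 2) := Real.arctan_pos.2 (by positivity)
  have hπ := Real.pi_pos
  have h6 : m ≤ π⁻¹ * (m * (2 * arctan (2 / κ))) := by
    calc m ≤ π⁻¹ * ∫ p in (-1 : ℝ)..1, (u p - g p) * poissonKernel κ k₀ p := h1
      _ ≤ π⁻¹ * (m * ∫ p in (-1 : ℝ)..1, poissonKernel κ k₀ p) := by gcongr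
      _ ≤ π⁻¹ * (m * (2 * arctan (2 / κ))) := by gcongr
  rw [h4] at h6
  have : π⁻¹ * (m * (π - 2 * arctan (κ / 2))) = m - m * (2 * arctan (κ / 2)) / π := by
    field_simp
  rw [this] at h6
  have : 0 < m * (2 * arctan (κ / 2)) / π := by positivity
  linarith

/-- **Comparison principle (supersolutions).** If `g` solves the Love equation on `[-1,1]`
and `u ≥ 1/(2π) + K_κ u` there (both continuous), then `g ≤ u`. [folklore] -/
theorem le_of_supersolution (hκ : 0 < κ) (hg : ContinuousOn g (Icc (-1) 1))
    (hgeq : ∀ k ∈ Icc (-1 : ℝ) 1,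
      g k = 1 / (2 * π) + π⁻¹ * ∫ p in (-1 : ℝ)..1, g p * poissonKernel κ k p)
    (hu : ContinuousOn u (Icc (-1) 1))
    (husup : ∀ k ∈ Icc (-1 : ℝ) 1,
      1 / (2 * π) + π⁻¹ * ∫ p in (-1 : ℝ)..1, u p * poissonKernel κ k p ≤ u k) :
    ∀ k ∈ Icc (-1 : ℝ) 1, g k ≤ u k := by
  have hw : ContinuousOn (fun k => g k - u k) (Icc (-1) 1) := hg.sub hu
  obtain ⟨k₀, hk₀, hmax⟩ :=
    isCompact_Icc.exists_isMaxOn (nonempty_Icc.2 (by norm_num)) hw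
  by_contra H
  push Not at H
  obtain ⟨k₁, hk₁, hlt⟩ := H
  set m := g k₀ - u k₀ with hm
  have hm_pos : 0 < m := lt_of_lt_of_le (by linarith) (hmax hk₁)
  have hle : ∀ p ∈ Icc (-1 : ℝ) 1, g p - u p ≤ m := fun p hp => hmax hp
  have h1 : m ≤ π⁻¹ * ∫ p in (-1 : ℝ)..1, (g p - u p) * poissonKernel κ k₀ p := by
    have := husup k₀ hk₀
    rw [hgeq k₀ hk₀] at hm
    have hsplit : ∫ p in (-1 : ℝ)..1, (g p - u p) * poissonKernel κ k₀ p
        = (∫ p in (-1 : ℝ)..1, g p * poissonKernel κ k₀ p)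
          - ∫ p in (-1 : ℝ)..1, u p * poissonKernel κ k₀ p := by
      rw [← intervalIntegral.integral_sub (intervalIntegrable_mul_poissonKernel hκ hg k₀)
        (intervalIntegrable_mul_poissonKernel hκ hu k₀)]
      congr 1; ext p; ring
    rw [hsplit, mul_sub]
    linarith
  have h2 : ∫ p in (-1 : ℝ)..1, (g p - u p) * poissonKernel κ k₀ p
      ≤ ∫ p in (-1 : ℝ)..1, m * poissonKernel κ k₀ p := by
    apply intervalIntegral.integral_mono_on (by norm_num)
      (intervalIntegrable_mul_poissonKernel hκ hw k₀)
      ((continuous_poissonKernel hκ k₀).intervalIntegrable _ _ |>.const_mul m)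
    intro p hp
    exact mul_le_mul_of_nonneg_right (hle p hp) (poissonKernel_pos hκ k₀ p).le
  rw [intervalIntegral.integral_const_mul] at h2
  have h3 := integral_poissonKernel_le hκ hk₀
  have h4 := two_arctan_two_div hκ
  have h5 : 0 < arctan (κ / 2) := Real.arctan_pos.2 (by positivity)
  have hπ := Real.pi_pos
  have h6 : m ≤ π⁻¹ * (m * (2 * arctan (2 / κ))) := by
    calc m ≤ π⁻¹ * ∫ p in (-1 : ℝ)..1, (g p - u p) * poissonKernel κ k₀ p := h1
      _ ≤ π⁻¹ * (m * ∫ p in (-1 : ℝ)..1, poissonKernel κ k₀ p) := by gcongr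
      _ ≤ π⁻¹ * (m * (2 * arctan (2 / κ))) := by gcongr
  rw [h4] at h6
  have : π⁻¹ * (m * (π - 2 * arctan (κ / 2))) = m - m * (2 * arctan (κ / 2)) / π := by
    field_simp
  rw [this] at h6
  have : 0 < m * (2 * arctan (κ / 2)) / π := by positivity
  linarith

end Comparison


/-! ### Sub- and supersolutions: the sandwich `√(1-k²)/(2πκ) ≤ g ≤ √(a²-k²)/(2πκ(1-θ))` -/

section Sandwich

variable {κ : ℝ} {g : ℝ → ℝ}

/-- `√(x + y) ≤ √x + y/(2√x)` for `x > 0`, `y ≥ 0`. [folklore] -/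
lemma sqrt_add_le {x y : ℝ} (hx : 0 < x) (hy : 0 ≤ y) : √(x + y) ≤ √x + y / (2 * √x) := by
  have hsx : 0 < √x := Real.sqrt_pos.2 hx
  rw [Real.sqrt_le_left (by positivity)]
  have : (√x + y / (2 * √x)) ^ 2 = x + y + (y / (2 * √x)) ^ 2 := by
    have h1 : √x ^ 2 = x := Real.sq_sqrt hx.le
    field_simp
    nlinarith [h1]
  rw [this]
  nlinarith

/-- **Lower bound (subsolution).** Every continuous solution of the Love equation on `[-1,1]`
satisfies `g(k) ≥ √(1-k²)/(2πκ)`: the semicircle is a subsolution because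
`K_κ[√(1-·²)](k) = B - κ ≥ √(1-k²) - κ`.  This is the rigorous form of LSSY's
`f(k, γ) ≈ (2πργ)^{-1}(4ρ²γ - k²)^{1/2}` (B.19) as a one-sided bound valid for all `γ`.
[cite: LSSY2005, App. B (B.19)] -/
theorem sqrt_div_le_solution (hκ : 0 < κ) (hg : ContinuousOn g (Icc (-1) 1))
    (hgeq : ∀ k ∈ Icc (-1 : ℝ) 1,
      g k = 1 / (2 * π) + π⁻¹ * ∫ p in (-1 : ℝ)..1, g p * poissonKernel κ k p) :
    ∀ k ∈ Icc (-1 : ℝ) 1, √(1 - k ^ 2) / (2 * π * κ) ≤ g k := by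
  have hπ := Real.pi_pos
  apply le_of_subsolution hκ hg hgeq (by fun_prop)
  intro k hk
  have hB := imRoot_pos k hκ
  have hI : ∫ p in (-1 : ℝ)..1, √(1 - p ^ 2) / (2 * π * κ) * poissonKernel κ k p
      = (2 * π * κ)⁻¹ * (π * (imRoot k κ - κ)) := by
    rw [← integral_sqrt_mul_poissonKernel k hκ, ← intervalIntegral.integral_const_mul]
    congr 1; ext p; ring
  rw [hI]
  have hle : √(1 - k ^ 2) ≤ imRoot k κ := by
    have h1 : 1 - k ^ 2 ≤ imRoot k κ ^ 2 := by
      have := dRoot_le_imRoot_sq k hκ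
      unfold dRoot at this
      nlinarith
    calc √(1 - k ^ 2) ≤ √(imRoot k κ ^ 2) := Real.sqrt_le_sqrt h1
      _ = imRoot k κ := Real.sqrt_sq hB.le
  have : 1 / (2 * π) + π⁻¹ * ((2 * π * κ)⁻¹ * (π * (imRoot k κ - κ)))
      = imRoot k κ / (2 * π * κ) := by
    field_simp
    ring
  rw [this]
  exact div_le_div_of_nonneg_right hle (by positivity)

/-- Solutions are nonnegative on `[-1, 1]`. [folklore] -/
theorem solution_nonneg (hκ : 0 < κ) (hg : ContinuousOn g (Icc (-1) 1))
    (hgeq : ∀ k ∈ Icc (-1 : ℝ) 1,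
      g k = 1 / (2 * π) + π⁻¹ * ∫ p in (-1 : ℝ)..1, g p * poissonKernel κ k p) :
    ∀ k ∈ Icc (-1 : ℝ) 1, 0 ≤ g k := by
  intro k hk
  refine le_trans ?_ (sqrt_div_le_solution hκ hg hgeq k hk)
  have := Real.pi_pos
  positivity

/-- `∫_{-1}^{1} g ≥ 1/(4κ)`, i.e. `γ = 4λ²/m` with `m = 4κ∫g ≥ 1` (leading order of (B.19)).
[cite: LSSY2005, App. B (B.19)] -/
theorem inv_four_mul_le_integral_solution (hκ : 0 < κ) (hg : ContinuousOn g (Icc (-1) 1))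
    (hgeq : ∀ k ∈ Icc (-1 : ℝ) 1,
      g k = 1 / (2 * π) + π⁻¹ * ∫ p in (-1 : ℝ)..1, g p * poissonKernel κ k p) :
    1 / (4 * κ) ≤ ∫ k in (-1 : ℝ)..1, g k := by
  have hπ := Real.pi_pos
  have h1 : ∫ k in (-1 : ℝ)..1, √(1 - k ^ 2) / (2 * π * κ) = 1 / (4 * κ) := by
    have : ∀ k : ℝ, √(1 - k ^ 2) / (2 * π * κ) = (2 * π * κ)⁻¹ * √(1 - k ^ 2) := by
      intro k; ring
    simp_rw [this, intervalIntegral.integral_const_mul, integral_sqrt_one_sub_sq]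
    field_simp
    ring
  rw [← h1]
  apply intervalIntegral.integral_mono_on (by norm_num) (Continuous.intervalIntegrable
    (by fun_prop) _ _)
  · exact hg.intervalIntegrable_of_Icc (by norm_num)
  · exact sqrt_div_le_solution hκ hg hgeq

/-- **Upper bound (supersolution).** For `a > 1`, `η = a² - 1`, `θ = κa²/(2η√η) < 1`, every
continuous solution satisfies `g(k) ≤ √(a²-k²)/(2πκ(1-θ))` on `[-1,1]`: shrinking the domain
of integration from `[-a,a]` to `[-1,1]` and `a B(k/a,κ/a) ≤ √(a²-k²) + κθ`. [folklore] -/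
theorem solution_le_sqrt_div (hκ : 0 < κ) (hg : ContinuousOn g (Icc (-1) 1))
    (hgeq : ∀ k ∈ Icc (-1 : ℝ) 1,
      g k = 1 / (2 * π) + π⁻¹ * ∫ p in (-1 : ℝ)..1, g p * poissonKernel κ k p)
    {a θ : ℝ} (ha : 1 < a) (hθ : θ = κ * a ^ 2 / (2 * (a ^ 2 - 1) * √(a ^ 2 - 1)))
    (hθ1 : θ < 1) :
    ∀ k ∈ Icc (-1 : ℝ) 1, g k ≤ √(a ^ 2 - k ^ 2) / (2 * π * κ * (1 - θ)) := by
  have hπ := Real.pi_pos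
  have ha0 : 0 < a := by linarith
  have hη : 0 < a ^ 2 - 1 := by nlinarith
  have hθ0 : 0 < θ := by rw [hθ]; positivity
  have h1θ : 0 < 1 - θ := by linarith
  apply le_of_supersolution hκ hg hgeq (by fun_prop)
  intro k hk
  have hk2 : k ^ 2 ≤ 1 := by nlinarith [hk.1, hk.2]
  set E := a ^ 2 - k ^ 2 with hE
  have hEη : a ^ 2 - 1 ≤ E := by rw [hE]; linarith
  have hE0 : 0 < E := lt_of_lt_of_le hη hEη
  -- Step 1: enlarge the domain of integration
  have hmono : ∫ p in (-1 : ℝ)..1, √(a ^ 2 - p ^ 2) * poissonKernel κ k p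
      ≤ π * (a * imRoot (k / a) (κ / a) - κ) := by
    rw [← integral_sqrt_mul_poissonKernel_scaled k hκ ha0]
    apply intervalIntegral.integral_mono_interval (by linarith) (by norm_num) (by linarith)
    · exact Filter.Eventually.of_forall fun p =>
        mul_nonneg (Real.sqrt_nonneg _) (poissonKernel_pos hκ k p).le
    · exact (Continuous.mul (by fun_prop) (continuous_poissonKernel hκ k)).intervalIntegrable _ _
  -- Step 2: `a B' ≤ √E + κ θ`
  have hB' := imRoot_pos (k / a) (div_pos hκ ha0)
  have hD' : dRoot (k / a) (κ / a) = (E + κ ^ 2) / a ^ 2 := by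
    simp only [dRoot, hE]; field_simp
  have hD'0 : 0 < dRoot (k / a) (κ / a) := by rw [hD']; positivity
  have hsq : (a * imRoot (k / a) (κ / a)) ^ 2 ≤ E + κ ^ 2 * a ^ 2 / E := by
    have h1 := imRoot_sq_le_bulk (k / a) (div_pos hκ ha0) hD'0
    rw [hD'] at h1
    have h2 : a ^ 2 * ((E + κ ^ 2) / a ^ 2 + (k / a) ^ 2 * (κ / a) ^ 2 / ((E + κ ^ 2) / a ^ 2))
        = E + κ ^ 2 + k ^ 2 * κ ^ 2 / (E + κ ^ 2) := by
      field_simp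
    have h3 : k ^ 2 * κ ^ 2 / (E + κ ^ 2) ≤ k ^ 2 * κ ^ 2 / E := by
      apply div_le_div_of_nonneg_left (by positivity) hE0 (by nlinarith)
    have h4 : κ ^ 2 + k ^ 2 * κ ^ 2 / E = κ ^ 2 * a ^ 2 / E := by
      have hE0' : E ≠ 0 := hE0.ne'
      field_simp
      rw [hE]; ring
    calc (a * imRoot (k / a) (κ / a)) ^ 2 = a ^ 2 * imRoot (k / a) (κ / a) ^ 2 := by ring
      _ ≤ a ^ 2 * ((E + κ ^ 2) / a ^ 2 + (k / a) ^ 2 * (κ / a) ^ 2 / ((E + κ ^ 2) / a ^ 2)) := by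
          gcongr
      _ = E + κ ^ 2 + k ^ 2 * κ ^ 2 / (E + κ ^ 2) := h2
      _ ≤ E + κ ^ 2 + k ^ 2 * κ ^ 2 / E := by linarith
      _ = E + κ ^ 2 * a ^ 2 / E := by rw [add_assoc, h4]
  have haB : a * imRoot (k / a) (κ / a) ≤ √E + κ * θ := by
    have h1 : a * imRoot (k / a) (κ / a) ≤ √(E + κ ^ 2 * a ^ 2 / E) := by
      apply Real.le_sqrt_of_sq_le hsq
    have h2 := sqrt_add_le hE0 (by positivity : 0 ≤ κ ^ 2 * a ^ 2 / E)
    have h3 : κ ^ 2 * a ^ 2 / E / (2 * √E) ≤ κ * θ := by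
      rw [hθ]
      have hsE : 0 < √E := Real.sqrt_pos.2 hE0
      have hsη : 0 < √(a ^ 2 - 1) := Real.sqrt_pos.2 hη
      have h4 : √(a ^ 2 - 1) ≤ √E := Real.sqrt_le_sqrt hEη
      rw [div_div, show κ * (κ * a ^ 2 / (2 * (a ^ 2 - 1) * √(a ^ 2 - 1)))
        = κ ^ 2 * a ^ 2 / (2 * (a ^ 2 - 1) * √(a ^ 2 - 1)) by ring]
      apply div_le_div_of_nonneg_left (by positivity) (by positivity)
      calc 2 * (a ^ 2 - 1) * √(a ^ 2 - 1) ≤ 2 * E * √E := by gcongr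
        _ = E * (2 * √E) := by ring
    linarith
  -- Step 3: assemble
  have hI : ∫ p in (-1 : ℝ)..1, √(a ^ 2 - p ^ 2) / (2 * π * κ * (1 - θ)) * poissonKernel κ k p
      = (2 * π * κ * (1 - θ))⁻¹ * ∫ p in (-1 : ℝ)..1, √(a ^ 2 - p ^ 2) * poissonKernel κ k p := by
    rw [← intervalIntegral.integral_const_mul]
    congr 1; ext p; ring
  rw [hI]
  have hden : 0 < 2 * π * κ * (1 - θ) := by positivity
  calc 1 / (2 * π) + π⁻¹ * ((2 * π * κ * (1 - θ))⁻¹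
        * ∫ p in (-1 : ℝ)..1, √(a ^ 2 - p ^ 2) * poissonKernel κ k p)
      ≤ 1 / (2 * π) + π⁻¹ * ((2 * π * κ * (1 - θ))⁻¹ * (π * (a * imRoot (k / a) (κ / a) - κ))) := by
        gcongr
    _ ≤ 1 / (2 * π) + π⁻¹ * ((2 * π * κ * (1 - θ))⁻¹ * (π * (√E + κ * θ - κ))) := by
        gcongr
    _ = √E / (2 * π * κ * (1 - θ)) := by
        field_simp
        ring

/-- **Sup bound.** `g ≤ 1/(4 arctan(κ/2))` on `[-1,1]` (maximum principle with
`K_κ 1 ≤ (2/π)arctan(2/κ)`); hence small `γ = κ/∫g` forces small `κ`. [folklore] -/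
theorem solution_le_const (hκ : 0 < κ) (hg : ContinuousOn g (Icc (-1) 1))
    (hgeq : ∀ k ∈ Icc (-1 : ℝ) 1,
      g k = 1 / (2 * π) + π⁻¹ * ∫ p in (-1 : ℝ)..1, g p * poissonKernel κ k p) :
    ∀ k ∈ Icc (-1 : ℝ) 1, g k ≤ 1 / (4 * arctan (κ / 2)) := by
  have hπ := Real.pi_pos
  have hat : 0 < arctan (κ / 2) := Real.arctan_pos.2 (by positivity)
  obtain ⟨k₀, hk₀, hmax⟩ :=
    isCompact_Icc.exists_isMaxOn (nonempty_Icc.2 (by norm_num)) hg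
  have hbound : g k₀ ≤ 1 / (4 * arctan (κ / 2)) := by
    have hg0 : 0 ≤ g k₀ := solution_nonneg hκ hg hgeq k₀ hk₀
    have h1 : ∫ p in (-1 : ℝ)..1, g p * poissonKernel κ k₀ p
        ≤ ∫ p in (-1 : ℝ)..1, g k₀ * poissonKernel κ k₀ p := by
      apply intervalIntegral.integral_mono_on (by norm_num)
        (intervalIntegrable_mul_poissonKernel hκ hg k₀)
        ((continuous_poissonKernel hκ k₀).intervalIntegrable _ _ |>.const_mul _)
      intro p hp
      exact mul_le_mul_of_nonneg_right (hmax hp) (poissonKernel_pos hκ k₀ p).le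
    rw [intervalIntegral.integral_const_mul] at h1
    have h2 := integral_poissonKernel_le hκ hk₀
    rw [two_arctan_two_div hκ] at h2
    have h3 : g k₀ ≤ 1 / (2 * π) + π⁻¹ * (g k₀ * (π - 2 * arctan (κ / 2))) := by
      calc g k₀ = 1 / (2 * π) + π⁻¹ * ∫ p in (-1 : ℝ)..1, g p * poissonKernel κ k₀ p :=
            hgeq k₀ hk₀
        _ ≤ 1 / (2 * π) + π⁻¹ * (g k₀ * ∫ p in (-1 : ℝ)..1, poissonKernel κ k₀ p) := by gcongr
        _ ≤ 1 / (2 * π) + π⁻¹ * (g k₀ * (π - 2 * arctan (κ / 2))) := by gcongr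
    have h4 : 1 / (2 * π) + π⁻¹ * (g k₀ * (π - 2 * arctan (κ / 2)))
        = g k₀ + (1 / 2 - g k₀ * (2 * arctan (κ / 2))) / π := by
      field_simp
      ring
    rw [h4] at h3
    have h5 : 0 ≤ 1 / 2 - g k₀ * (2 * arctan (κ / 2)) := by
      by_contra h
      have : (1 / 2 - g k₀ * (2 * arctan (κ / 2))) / π < 0 :=
        div_neg_of_neg_of_pos (lt_of_not_ge h) hπ
      linarith
    rw [le_div_iff₀ (by positivity)]
    linarith
  intro k hk
  exact le_trans (hmax hk) hbound

/-- `∫_{-1}^{1} g ≤ 1/(2 arctan(κ/2))`. [folklore] -/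
theorem integral_solution_le (hκ : 0 < κ) (hg : ContinuousOn g (Icc (-1) 1))
    (hgeq : ∀ k ∈ Icc (-1 : ℝ) 1,
      g k = 1 / (2 * π) + π⁻¹ * ∫ p in (-1 : ℝ)..1, g p * poissonKernel κ k p) :
    ∫ k in (-1 : ℝ)..1, g k ≤ 1 / (2 * arctan (κ / 2)) := by
  have hat : 0 < arctan (κ / 2) := Real.arctan_pos.2 (by positivity)
  have h1 : ∫ k in (-1 : ℝ)..1, g k ≤ ∫ _k in (-1 : ℝ)..1, 1 / (4 * arctan (κ / 2)) := by
    apply intervalIntegral.integral_mono_on (by norm_num)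
      (hg.intervalIntegrable_of_Icc (by norm_num)) intervalIntegrable_const
    exact solution_le_const hκ hg hgeq
  rw [intervalIntegral.integral_const, smul_eq_mul] at h1
  have : ((1 : ℝ) - -1) * (1 / (4 * arctan (κ / 2))) = 1 / (2 * arctan (κ / 2)) := by
    field_simp; norm_num
  linarith

end Sandwich

/-! ### Duality: `⟨(I - K_κ)v, g⟩ = (1/2π)∫ v` -/

section Duality

variable {κ : ℝ} {g : ℝ → ℝ}

/-- **Duality identity.** For a continuous solution `g` of the Love equation on `[-1,1]` and a
continuous test function `v`,
`∫_{-1}^{1} v g - (1/π)∫_{-1}^{1} (∫_{-1}^{1} v(p) P_κ(k,p) dp) g(k) dk = (1/2π)∫_{-1}^{1} v`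
(Fubini and the symmetry of the kernel). [folklore] -/
theorem duality (hκ : 0 < κ) (hg : ContinuousOn g (Icc (-1) 1))
    (hgeq : ∀ k ∈ Icc (-1 : ℝ) 1,
      g k = 1 / (2 * π) + π⁻¹ * ∫ p in (-1 : ℝ)..1, g p * poissonKernel κ k p)
    {v : ℝ → ℝ} (hv : Continuous v) :
    (∫ k in (-1 : ℝ)..1, v k * g k)
      - π⁻¹ * ∫ k in (-1 : ℝ)..1, (∫ p in (-1 : ℝ)..1, v p * poissonKernel κ k p) * g k
      = 1 / (2 * π) * ∫ k in (-1 : ℝ)..1, v k := by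
  have hπ := Real.pi_pos
  -- Fubini
  have hF : ContinuousOn (fun q : ℝ × ℝ => v q.2 * poissonKernel κ q.1 q.2 * g q.1)
      (Icc (-1) 1 ×ˢ Icc (-1) 1) := by
    apply ContinuousOn.mul
    · apply ContinuousOn.mul (by fun_prop)
      exact (continuous_poissonKernel_uncurry hκ).continuousOn
    · exact hg.comp continuous_fst.continuousOn fun q hq => hq.1
  have hFint : IntegrableOn (fun q : ℝ × ℝ => v q.2 * poissonKernel κ q.1 q.2 * g q.1)
      (uIoc (-1 : ℝ) 1 ×ˢ uIoc (-1 : ℝ) 1) := by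
    apply (hF.integrableOn_compact (isCompact_Icc.prod isCompact_Icc)).mono_set
    rw [uIoc_of_le (by norm_num)]
    exact prod_mono Ioc_subset_Icc_self Ioc_subset_Icc_self
  have hswap := MeasureTheory.intervalIntegral_intervalIntegral_swap
    (F := fun k p => v p * poissonKernel κ k p * g k) hFint
  have hpull : ∫ k in (-1 : ℝ)..1, (∫ p in (-1 : ℝ)..1, v p * poissonKernel κ k p) * g k
      = ∫ k in (-1 : ℝ)..1, ∫ p in (-1 : ℝ)..1, v p * poissonKernel κ k p * g k := by
    congr 1; ext k
    rw [← intervalIntegral.integral_mul_const]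
  -- the inner `k`-integral after the swap, for `p ∈ [-1, 1]`
  have hinner : EqOn (fun p => ∫ k in (-1 : ℝ)..1, v p * poissonKernel κ k p * g k)
      (fun p => π * (v p * g p) - 1 / 2 * v p) (uIcc (-1 : ℝ) 1) := by
    intro p hp
    rw [uIcc_of_le (by norm_num)] at hp
    simp only
    have h1 : ∫ k in (-1 : ℝ)..1, v p * poissonKernel κ k p * g k
        = v p * ∫ k in (-1 : ℝ)..1, g k * poissonKernel κ p k := by
      rw [← intervalIntegral.integral_const_mul]
      congr 1; ext k
      rw [poissonKernel_comm]; ring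
    rw [h1]
    have h2 := hgeq p hp
    have h3 : ∫ k in (-1 : ℝ)..1, g k * poissonKernel κ p k = π * (g p - 1 / (2 * π)) := by
      rw [h2]; field_simp; ring
    rw [h3]; field_simp
  rw [hpull, hswap, intervalIntegral.integral_congr hinner, intervalIntegral.integral_sub,
    intervalIntegral.integral_const_mul, intervalIntegral.integral_const_mul]
  · field_simp
    ring
  · apply IntervalIntegrable.const_mul
    apply ContinuousOn.intervalIntegrable
    rw [uIcc_of_le (by norm_num)]
    exact hv.continuousOn.mul hg
  · exact (Continuous.intervalIntegrable (by fun_prop) _ _)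

end Duality

end Literature.Barriers.AtomisticToContinuum.BoseGas.LiebLiniger

end
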